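import Literature.NumberTheory.EllipticCurves.ModularDegreeGRHBoundProofs
import HarnessLib

/-!
# The GRH line of the modular method WITHOUT Deligne's bound: `log δ_{1,N} ≤ (1/6) N log log N + O(N)`
# and `log c ≤ 1537 · rad · log log rad` from modularity, Mazur–Kenku, Pasten's Thm 7.3 and GRH (proofs)

Topic `Literature/NumberTheory/EllipticCurves` (family `abc`, LADDER-ABC A1, the *modular method*;
cell abc-stewartyu, seat lit-abc-pasten g5). Theorems only — NO new statement, NO new named fact
(D-0026). Companion of `ModularDegreeGRHBoundProofs.lean` (seat g4), which proves Pasten's Thm 7.4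
(`D = 1`), the GRH clauses of Thm 7.5 and the conditional rung A1.P(GRH)
`abc_log_le_mul_rad_mul_loglog_of_grh` from {modularity, Mazur–Kenku, Deligne (weight 2), Thm 7.3}
and the GRH hypothesis. Source: H. Pasten, *Shimura curves and the abc conjecture*, J. Number Theory
**254** (2024) = arXiv:1705.09251v4 [`PastenShimura2024`], §7.3 Thm 7.3, proof of Thm 7.4 (p. 27)
run with the proof of Thm 7.2 (p. 26), §7.4, §3.

## The point

In the printed proof of Thm 7.4, Deligne's bound `|a_p| ≤ 2√p` only halves the logarithm of the
distinguishing prime: `η_{[χ₀]}(c) ≤ (4√p_{f,g})^{#c}` versus the TRIVIAL Hecke bound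
`|a_p| ≤ p + 1` (`norm_eigenvalue_heckeT_gamma0_two_le`, PROVED in the tree: Diamond–Shurman
Prop. 5.5.2(a)), which gives `η_{[χ₀]}(c) ≤ (2(p_{f,g} + 1))^{#c}`. With `p_{f,g} < C (log N)²`
(Thm 7.3 under GRH) both are `O(#c · log log N)`; the constant `1/12` of Thm 7.4 becomes `1/6`, the
GRH clauses of Thm 7.5 become `h(E) < (1/12 + ε) N log log N`, `log|Δ_E| < (1 + ε) N log log N`, and
the `abc` translation at `ε = 1/2` gives the SAME rung statement as the sibling's
`abc_log_le_mul_rad_mul_loglog_of_grh` — `log c ≤ 1537 · rad(abc) · log log rad(abc)` for `c ≥ c₀`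
(the sibling used `ε = 1` with Deligne's `1/2`; `1 + 1024 · 3/2 = 1537` either way) — with Deligne's
theorem REMOVED from the hypotheses:

* `Pasten2024.log_heckeCongruenceModulus_le_of_distinguishingIndex_trivialBound`,
  `Pasten2024.log_modularDegree_le_card_mul_of_distinguishingIndex_trivialBound` — the §7.2 engine
  with the trivial bound: `log η_{[χ₀]}(P) ≤ #c · log(2(X + 1))`, `log δ_{1,N} ≤ (Σ #c) log(2(X + 1))`
  from a distinguishing index `≤ X`.
* `Pasten2024.exists_log_modularDegree_le_loglog_of_thm_7_3_trivialBound` —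
  `log δ_{1,N} ≤ (1/6) N log log N + K N` at every level `N ≥ 16` where GRH holds for the relevant
  Rankin–Selberg pairs (NOT the printed `1/12`: weaker constant, smaller trust base).
* `faltingsHeight_discriminant_lt_loglog_of_grh_of_thm_7_3` — `h(E) < (1/12 + ε) N log log N` and
  `log|Δ_E| < (1 + ε) N log log N` for `N ≫_ε 1`, from {modularity, Mazur–Kenku, Thm 7.3} + GRH
  (NOT Thm 7.5's printed `1/24`, `1/2`).
* `abc_log_le_mul_rad_mul_loglog_of_grh_of_thm_7_3` — **A1.P(GRH) with trust base
  {`nonempty_modularParametrizationData`, `PastenShimura2024_minimalDegree_le_163_mul`,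
  `PastenShimura2024_thm_7_3`} + the GRH hypothesis**: `∃ c₀, ∀ abc triples with c ≥ c₀,
  log c ≤ 1537 · rad(abc) · log log rad(abc)`.

WHAT THIS IS NOT: nothing about GRH is asserted; the `1/6`, `1/12`, `1 + ε` constants are NOT
Pasten's printed ones (those need Deligne; sibling file); still exponential in `rad`; no `abc` claim.
References: [PastenShimura2024] arXiv:1705.09251v4 Thm 7.3 (p. 26), proofs of Thms 7.2/7.4
(pp. 26–27), Thm 7.5 (p. 27), §3 (p. 13); [DiamondShurman2005] GTM 228 Prop. 5.5.2(a);
[MurtyPasten2013] J. Number Theory 133 (2013) §8.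
-/

noncomputable section

open scoped MatrixGroups ModularForm

open WeierstrassCurve CongruenceSubgroup UpperHalfPlane

namespace Literature.NumberTheory.EllipticCurves

open ModularForms Pasten2024 DiophantineGeometry

/-- `log log N → ∞`: for every `T` there is `N₁` with `T < log log N` for all `N ≥ N₁`. [folklore] -/
private theorem exists_nat_lt_loglog (T : ℝ) :
    ∃ N₁ : ℕ, ∀ N : ℕ, N₁ ≤ N → T < Real.log (Real.log (N : ℝ)) := by
  refine ⟨⌈Real.exp (Real.exp T)⌉₊ + 1, fun N hN => ?_⟩
  have hN' : Real.exp (Real.exp T) < (N : ℝ) := by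
    have h1 : Real.exp (Real.exp T) ≤ (⌈Real.exp (Real.exp T)⌉₊ : ℝ) := Nat.le_ceil _
    have h2 : ((⌈Real.exp (Real.exp T)⌉₊ + 1 : ℕ) : ℝ) ≤ N := by exact_mod_cast hN
    push_cast at h2
    linarith
  have hNpos : (0 : ℝ) < N := lt_trans (Real.exp_pos _) hN'
  have hlog : Real.exp T < Real.log (N : ℝ) := (Real.lt_log_iff_exp_lt hNpos).mpr hN'
  have hlogpos : 0 < Real.log (N : ℝ) := lt_trans (Real.exp_pos _) hlog
  exact (Real.lt_log_iff_exp_lt hlogpos).mpr hlog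

/-- `2 ≤ log N` and `1 ≤ log log N` for `N ≥ 16`. [folklore] -/
private theorem two_le_log_and_one_le_loglog {N : ℕ} (hN : 16 ≤ N) :
    2 ≤ Real.log (N : ℝ) ∧ 1 ≤ Real.log (Real.log (N : ℝ)) := by
  have hN' : (16 : ℝ) ≤ N := by exact_mod_cast hN
  have hl2 := Real.log_two_gt_d9
  have he := Real.exp_one_lt_d9
  have h16 : Real.log 16 = 4 * Real.log 2 := by
    rw [show (16 : ℝ) = 2 ^ 4 by norm_num, Real.log_pow]; norm_num
  have hlog16 : Real.log 16 ≤ Real.log N := Real.log_le_log (by norm_num) hN'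
  have hlogN : 0 < Real.log (N : ℝ) := by linarith
  refine ⟨by linarith, ?_⟩
  rw [Real.le_log_iff_exp_le hlogN]
  linarith

namespace Pasten2024

variable {N : ℕ} [NeZero N] {W : WeierstrassCurve ℚ}

/-! ### The §7.2 engine with the trivial Hecke bound -/

/-- **`log η_{[χ₀]}(c) ≤ #c · log(2(X + 1))` from a distinguishing index `n_c ≤ X` and the TRIVIAL
Hecke bound** (the chain of the proof of Thm 7.2, p. 26, at a distinguishing PRIME `p ≤ n_c ≤ X`,
`p ∤ N`, with `|a_p| ≤ p + 1 ≤ X + 1` for all eigenvalues of `T_p` on `S₂(Γ₀(N))`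
(`norm_eigenvalue_heckeT_gamma0_two_le`) in place of Deligne's `2√p`:
`η ≤ (X + 1 + |a_p(f)|)^{#c} ≤ (2(X + 1))^{#c}` by `log_heckeCongruenceModulus_le_of_not_mem_of_bound`).
Hypothesis `hX` exactly as in `log_heckeCongruenceModulus_le_of_distinguishingIndex`.
[cite: PastenShimura2024, proof of Thm. 7.2 (p. 26) and Prop. 5.4] [cite: DiamondShurman2005, Prop. 5.5.2(a)] -/
theorem log_heckeCongruenceModulus_le_of_distinguishingIndex_trivialBound {X : ℝ} (hX0 : 0 ≤ X)
    (hX : ∀ (M : ℕ) [NeZero M], M ∣ N →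
      ∀ (f : CuspForm (Gamma0 N) 2) (g : CuspForm (Gamma0 M) 2), IsNewform0 f → IsNewform0 g →
        (∃ n : ℕ, n.Coprime N ∧ (qExpansion 1 ⇑f).coeff n ≠ (qExpansion 1 ⇑g).coeff n) →
          ∃ n : ℕ, n.Coprime N ∧ (n : ℝ) ≤ X ∧
            (qExpansion 1 ⇑f).coeff n ≠ (qExpansion 1 ⇑g).coeff n)
    [W.IsElliptic] (D : ModularParametrizationData W N) {P : Ideal (anemicHeckeRing N 2)}
    (hP : P ∈ minimalPrimes (anemicHeckeRing N 2)) (hPne : P ≠ eigenIdeal D.f) :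
    Real.log (heckeCongruenceModulus D.f P) ≤
      (Module.finrank ℤ (anemicHeckeRing N 2 ⧸ P) : ℝ) * Real.log (2 * (X + 1)) := by
  have hf := D.hasIntegralEigenvalues_f
  have hf0 := D.f_ne_zero
  have hnew : IsNewform0 D.f := D.isNewformOf.1
  -- (1) `P` is the eigen-ideal of an Atkin–Lehner form of a newform `g` of level `M ∣ N`
  obtain ⟨x, g, hg, hφ0, hPφ⟩ := exists_isNewform0_eigenIdeal_eq_of_mem_minimalPrimes hP
  have hMN : x.1.1 ∣ N := (dvd_mul_right _ _).trans x.2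
  -- (2) `f` and `g` differ at some index prime to `N` (else `P = 𝕀_{[χ₀]}`)
  have hdiff : ∃ n : ℕ, n.Coprime N ∧ (qExpansion 1 ⇑D.f).coeff n ≠ (qExpansion 1 ⇑g).coeff n := by
    by_contra hcon
    push Not at hcon
    have heq : eigenIdeal (degeneracyMap0 x.1.1 N x.1.2 2 g) = eigenIdeal D.f := by
      refine eigenIdeal_eq_of_forall_heckeT_eq_smul (isAnemicEigenvector_degeneracyMap0 x hg) hφ0
        hf.isAnemicEigenvector hf0 fun p hp hpN ↦ ?_
      haveI : NeZero p := ⟨hp.ne_zero⟩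
      refine ⟨(qExpansion 1 ⇑g).coeff p, heckeT_degeneracyMap0_eq_coeff_smul x hg p hp hpN, ?_⟩
      rw [← hcon p ((Nat.Prime.coprime_iff_not_dvd hp).mpr hpN)]
      exact hnew.heckeT_eq_coeff_smul hp
    exact hPne (hPφ.trans heq)
  -- (2') hence (`hX`) at an index `n ≤ X` prime to `N`, hence at a PRIME `p ≤ n ≤ X`, `p ∤ N`
  obtain ⟨n, hn, hnX, hne_n⟩ := hX x.1.1 hMN D.f g hnew hg hdiff
  have hdist : ∃ p : ℕ, p.Prime ∧ ¬ p ∣ N ∧ (p : ℝ) ≤ X ∧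
      (qExpansion 1 ⇑D.f).coeff p ≠ (qExpansion 1 ⇑g).coeff p := by
    by_contra hcon
    push Not at hcon
    refine hne_n (hnew.coeff_eq_of_coprime_of_lt hg hMN (B := n + 1) (fun p hp hpN hpB ↦ ?_) hn
      (Nat.lt_succ_self n))
    have hpn : (p : ℝ) ≤ n := by exact_mod_cast Nat.lt_succ_iff.mp hpB
    exact hcon p hp hpN (hpn.trans hnX)
  obtain ⟨p, hp, hpN, hpX, hne⟩ := hdist
  haveI : NeZero p := ⟨hp.ne_zero⟩
  -- (3) `T_p - a_p(f) ∉ P`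
  set t : anemicHeckeRing N 2 := anemicHeckeRing.T N 2 p hp hpN with ht
  set a : ℤ := intEigencharacter hf hf0 t with ha_def
  have ha : (a : ℂ) = (qExpansion 1 ⇑D.f).coeff p := by
    rw [ha_def, cast_intEigencharacter, ht, eigencharacter_T,
      heckeEigenvalue_eq_coeff_of_isNormalized hnew.2.2 hp (hnew.2.1 p hp)]
  have htP : t - (a : anemicHeckeRing N 2) ∉ P := by
    rw [hPφ, T_sub_intCast_mem_eigenIdeal_iff hφ0 hp hpN
      (heckeT_degeneracyMap0_eq_coeff_smul x hg p hp hpN), ha]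
    exact fun h ↦ hne h.symm
  -- (4) the trivial bound `|μ| ≤ p + 1 ≤ X + 1` at `p`, and Prop 5.4
  exact log_heckeCongruenceModulus_le_of_not_mem_of_bound D hp hpN (G := X + 1) (by linarith)
    (fun μ hμ ↦ (norm_eigenvalue_heckeT_gamma0_two_le (N := N) (p := p) hp hpN hμ).trans
      (by linarith)) hP hPne htP

/-- **`log δ_{1,N} ≤ (Σ_{c ≠ [χ₀]} #c) · log(2(X + 1))`** for an optimal datum, from Thm 5.5
(`h55`) and `log_heckeCongruenceModulus_le_of_distinguishingIndex_trivialBound` (as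
`log_modularDegree_le_card_mul_of_distinguishingIndex`, trivial Hecke bound in place of Deligne).
[cite: PastenShimura2024, proof of Thm. 7.2, p. 26] -/
theorem log_modularDegree_le_card_mul_of_distinguishingIndex_trivialBound
    (h55 : PastenShimura2024_thm_5_5) {X : ℝ} (hX0 : 0 ≤ X)
    (hX : ∀ (M : ℕ) [NeZero M], M ∣ N →
      ∀ (f : CuspForm (Gamma0 N) 2) (g : CuspForm (Gamma0 M) 2), IsNewform0 f → IsNewform0 g →
        (∃ n : ℕ, n.Coprime N ∧ (qExpansion 1 ⇑f).coeff n ≠ (qExpansion 1 ⇑g).coeff n) →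
          ∃ n : ℕ, n.Coprime N ∧ (n : ℝ) ≤ X ∧
            (qExpansion 1 ⇑f).coeff n ≠ (qExpansion 1 ⇑g).coeff n)
    [W.IsElliptic] (D : ModularParametrizationData W N)
    (hmin : ∀ (W' : WeierstrassCurve ℚ) [W'.IsElliptic] (D' : ModularParametrizationData W' N),
      D'.f = D.f → D.modularDegree ≤ D'.modularDegree) :
    Real.log (D.modularDegree : ℝ) ≤
      (∑ P ∈ (finite_minimalPrimes_anemicHeckeRing N 2).toFinset.erase (eigenIdeal D.f),
          (Module.finrank ℤ (anemicHeckeRing N 2 ⧸ P) : ℝ)) * Real.log (2 * (X + 1)) := by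
  have h1 := log_modularDegree_le_sum_log_heckeCongruenceModulus h55 D hmin
  have h3 : ∑ P ∈ (finite_minimalPrimes_anemicHeckeRing N 2).toFinset.erase (eigenIdeal D.f),
        Real.log (heckeCongruenceModulus D.f P : ℝ) ≤
      ∑ P ∈ (finite_minimalPrimes_anemicHeckeRing N 2).toFinset.erase (eigenIdeal D.f),
        (Module.finrank ℤ (anemicHeckeRing N 2 ⧸ P) : ℝ) * Real.log (2 * (X + 1)) := by
    refine Finset.sum_le_sum fun P hP =>
      log_heckeCongruenceModulus_le_of_distinguishingIndex_trivialBound hX0 hX D ?_ ?_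
    · exact (finite_minimalPrimes_anemicHeckeRing N 2).mem_toFinset.mp (Finset.mem_of_mem_erase hP)
    · exact Finset.ne_of_mem_erase hP
  rw [← Finset.sum_mul] at h3
  exact h1.trans h3

end Pasten2024

/-! ### `log δ_{1,N} ≤ (1/6) N log log N + O(N)` under GRH, without Deligne -/

/-- **`log δ_{1,N} ≤ (1/6) N log log N + K N` at every level `N ≥ 16` where GRH holds for the
relevant Rankin–Selberg `L`-functions**, from Thm 7.3 ALONE among the analytic named facts (no
Deligne): Thm 5.5 (PROVED) + `η(c) ≤ (2(p_{f,g} + 1))^{#c}` with `p_{f,g} < C (log N)²` (Thm 7.3),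
`2(C (log N)² + 1) ≤ 4 C (log N)²`, so `log δ_{1,N} ≤ (Σ_{c ≠ [χ₀]} #c)(log 4C + 2 log log N)`, and
`Σ #c ≤ N/12 + (25/12) d(N)³ √N` puts everything but `(1/6) N log log N` into `K N`. (Pasten's
printed road, with Deligne, gives `1/12`: sibling `exists_log_modularDegree_le_loglog_of_thm_7_3`.)
[cite: PastenShimura2024, Theorem 7.4 (proof, arXiv p. 27) with Theorem 7.2 (proof, p. 26) and Prop. 7.1] -/
theorem Pasten2024.exists_log_modularDegree_le_loglog_of_thm_7_3_trivialBound
    (h73 : PastenShimura2024_thm_7_3) :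
    ∃ K : ℝ, 0 ≤ K ∧ ∀ (N : ℕ) [NeZero N], 16 ≤ N →
      (∀ (M : ℕ) [NeZero M], M ∣ N → ∀ (f : CuspForm (Gamma0 N) 2) (g : CuspForm (Gamma0 M) 2),
          IsNewform0 f → IsNewform0 g → RankinSelbergGRH f f ∧ RankinSelbergGRH f g) →
      ∀ (W : WeierstrassCurve ℚ) [W.IsElliptic] (D : ModularParametrizationData W N),
        (∀ (W' : WeierstrassCurve ℚ) [W'.IsElliptic] (D' : ModularParametrizationData W' N),
            D'.f = D.f → D.modularDegree ≤ D'.modularDegree) →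
          Real.log (D.modularDegree : ℝ) ≤
            (1 / 6 : ℝ) * N * Real.log (Real.log N) + K * N := by
  obtain ⟨C, hC1, hC⟩ := h73.exists_distinguishingIndex_le
  obtain ⟨Cd, hCd1, hCd⟩ := Sieve.exists_card_divisors_le_mul_rpow' (ε := 1 / 12) (by norm_num)
  -- `c₀ = log 4 + log C ≥ 0`
  set c₀ : ℝ := Real.log 4 + Real.log C with hc₀def
  have hlogC : 0 ≤ Real.log C := Real.log_nonneg hC1
  have hc₀ : 0 ≤ c₀ := by
    have : 0 ≤ Real.log 4 := Real.log_nonneg (by norm_num)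
    rw [hc₀def]; linarith
  have hCd0 : 0 ≤ Cd := le_trans zero_le_one hCd1
  refine ⟨c₀ / 12 + 25 / 12 * Cd ^ 3 * (c₀ + 8), by positivity, fun N _ hN hGRH W _ D hmin => ?_⟩
  obtain ⟨hL, hM⟩ := two_le_log_and_one_le_loglog hN
  have hN' : (16 : ℝ) ≤ N := by exact_mod_cast hN
  have hNpos : (0 : ℝ) < N := by linarith
  set L : ℝ := Real.log N with hLdef
  set M : ℝ := Real.log L with hMdef
  -- the engine with `X = C (log N)²`
  have hX := hC N hGRH
  have hXnonneg : 0 ≤ C * Real.log N ^ 2 := by positivity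
  have hmain := Pasten2024.log_modularDegree_le_card_mul_of_distinguishingIndex_trivialBound
    PastenShimura2024_thm_5_5_holds hXnonneg (X := C * Real.log N ^ 2)
    (fun M _ hMN f g hf hg hdiff => hX M hMN f g hf hg hdiff) D hmin
  -- `log(2(X + 1)) ≤ log(4 C L²) = c₀ + 2M`
  have hlogX : Real.log (2 * (C * Real.log N ^ 2 + 1)) ≤ c₀ + 2 * M := by
    have hLpos : 0 < L := by linarith
    have hCL : 1 ≤ C * L ^ 2 := by nlinarith
    have h1 : 2 * (C * L ^ 2 + 1) ≤ 4 * C * L ^ 2 := by nlinarith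
    have h2 : Real.log (2 * (C * L ^ 2 + 1)) ≤ Real.log (4 * C * L ^ 2) :=
      Real.log_le_log (by positivity) h1
    have h3 : Real.log (4 * C * L ^ 2) = Real.log 4 + Real.log C + 2 * M := by
      rw [Real.log_mul (by positivity) (by positivity), Real.log_mul (by norm_num) (by positivity),
        Real.log_pow]
      push_cast
      ring
    rw [hc₀def]
    linarith
  -- the class count
  set S : ℝ := ∑ P ∈ (finite_minimalPrimes_anemicHeckeRing N 2).toFinset.erase (eigenIdeal D.f),
      (Module.finrank ℤ (anemicHeckeRing N 2 ⧸ P) : ℝ) with hSdef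
  have hS0 : 0 ≤ S := Finset.sum_nonneg fun _ _ => Nat.cast_nonneg _
  set d : ℝ := (N.divisors.card : ℝ) with hddef
  have hd0 : 0 ≤ d := Nat.cast_nonneg _
  have hST : S ≤ (N : ℝ) / 12 + 25 / 12 * d ^ 3 * Real.sqrt N :=
    MurtyPasten.sum_erase_finrank_quotient_le_explicit D
  -- the error term `d³ √N (c₀ + 2M) ≤ Cd³ (c₀ + 8) N`
  have hd : d ≤ Cd * (N : ℝ) ^ (1 / 12 : ℝ) := hCd N
  have hd3 : d ^ 3 ≤ Cd ^ 3 * (N : ℝ) ^ (1 / 4 : ℝ) := by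
    have h3 : d ^ 3 ≤ (Cd * (N : ℝ) ^ (1 / 12 : ℝ)) ^ 3 := pow_le_pow_left₀ hd0 hd 3
    have hq : ((N : ℝ) ^ (1 / 12 : ℝ)) ^ 3 = (N : ℝ) ^ (1 / 4 : ℝ) := by
      rw [← Real.rpow_natCast, ← Real.rpow_mul hNpos.le]; norm_num
    calc d ^ 3 ≤ (Cd * (N : ℝ) ^ (1 / 12 : ℝ)) ^ 3 := h3
      _ = Cd ^ 3 * ((N : ℝ) ^ (1 / 12 : ℝ)) ^ 3 := by ring
      _ = Cd ^ 3 * (N : ℝ) ^ (1 / 4 : ℝ) := by rw [hq]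
  have hsqrt : Real.sqrt N = (N : ℝ) ^ (1 / 2 : ℝ) := Real.sqrt_eq_rpow _
  have hlogle : L ≤ 4 * (N : ℝ) ^ (1 / 4 : ℝ) := by
    have h := Real.log_le_rpow_div hNpos.le (show (0 : ℝ) < 1 / 4 by norm_num)
    have : (N : ℝ) ^ (1 / 4 : ℝ) / (1 / 4) = 4 * (N : ℝ) ^ (1 / 4 : ℝ) := by ring
    linarith [this ▸ h]
  have hML : M ≤ L := by
    have hLpos : 0 < L := by linarith
    have := Real.log_le_sub_one_of_pos hLpos
    linarith
  have hq1 : 1 ≤ (N : ℝ) ^ (1 / 4 : ℝ) := Real.one_le_rpow (by linarith) (by norm_num)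
  have hrpow : (N : ℝ) ^ (1 / 4 : ℝ) * (N : ℝ) ^ (1 / 2 : ℝ) * (N : ℝ) ^ (1 / 4 : ℝ) = N := by
    rw [← Real.rpow_add hNpos, ← Real.rpow_add hNpos]; norm_num
  have hq2 : 0 ≤ (N : ℝ) ^ (1 / 2 : ℝ) := by positivity
  have herr : d ^ 3 * Real.sqrt N * (c₀ + 2 * M) ≤ Cd ^ 3 * (c₀ + 8) * N := by
    rw [hsqrt]
    have hcM : c₀ + 2 * M ≤ (c₀ + 8) * (N : ℝ) ^ (1 / 4 : ℝ) := by nlinarith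
    have hcM0 : 0 ≤ c₀ + 2 * M := by linarith
    calc d ^ 3 * (N : ℝ) ^ (1 / 2 : ℝ) * (c₀ + 2 * M)
        ≤ (Cd ^ 3 * (N : ℝ) ^ (1 / 4 : ℝ)) * (N : ℝ) ^ (1 / 2 : ℝ) *
            ((c₀ + 8) * (N : ℝ) ^ (1 / 4 : ℝ)) := by gcongr
      _ = Cd ^ 3 * (c₀ + 8) * ((N : ℝ) ^ (1 / 4 : ℝ) * (N : ℝ) ^ (1 / 2 : ℝ) * (N : ℝ) ^ (1 / 4 : ℝ)) := by
          ring
      _ = Cd ^ 3 * (c₀ + 8) * N := by rw [hrpow]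
  -- assemble
  have hcM0 : 0 ≤ c₀ + 2 * M := by linarith
  have hlog2X0 : 0 ≤ Real.log (2 * (C * Real.log N ^ 2 + 1)) := by
    apply Real.log_nonneg
    nlinarith
  calc Real.log (D.modularDegree : ℝ)
      ≤ S * Real.log (2 * (C * Real.log N ^ 2 + 1)) := hmain
    _ ≤ S * (c₀ + 2 * M) := mul_le_mul_of_nonneg_left hlogX hS0
    _ ≤ ((N : ℝ) / 12 + 25 / 12 * d ^ 3 * Real.sqrt N) * (c₀ + 2 * M) :=
        mul_le_mul_of_nonneg_right hST hcM0
    _ = (1 / 6 : ℝ) * N * M + c₀ / 12 * N + 25 / 12 * (d ^ 3 * Real.sqrt N * (c₀ + 2 * M)) := by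
        ring
    _ ≤ (1 / 6 : ℝ) * N * M + c₀ / 12 * N + 25 / 12 * (Cd ^ 3 * (c₀ + 8) * N) := by gcongr
    _ = (1 / 6 : ℝ) * N * M + (c₀ / 12 + 25 / 12 * Cd ^ 3 * (c₀ + 8)) * N := by ring

/-! ### Height and discriminant under GRH from modularity, Mazur–Kenku and Thm 7.3 -/

/-- **`h(E) < (1/12 + ε) N log log N` and `log|Δ_E| < (1 + ε) N log log N` for `N ≫_ε 1`, under GRH,
from {modularity, Mazur–Kenku, Thm 7.3}** (the §7.4 deduction of the sibling's
`PastenShimura2024_thm_7_5_grh` — (EqHDeg) `faltingsHeight_le_of_class_bound`, (EqDiscH)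
`log_minimalDiscriminantNorm_le_of_modularity'` on a global minimal model — fed with the Deligne-free
engine `Pasten2024.exists_log_modularDegree_le_loglog_of_thm_7_3_trivialBound`; constants twice the
printed `1/24`, `1/2` of Thm 7.5, which need Deligne). GRH for all Rankin–Selberg pairs of weight-`2`
newforms is the HYPOTHESIS `hGRH`; nothing about GRH is asserted.
[cite: PastenShimura2024, Theorem 7.5 (GRH clause; proof §7.4, arXiv p. 27)] -/
theorem faltingsHeight_discriminant_lt_loglog_of_grh_of_thm_7_3
    (hmod : nonempty_modularParametrizationData) (h163 : PastenShimura2024_minimalDegree_le_163_mul)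
    (h73 : PastenShimura2024_thm_7_3)
    (hGRH : ∀ (N₁ N₂ : ℕ) [NeZero N₁] [NeZero N₂] (f : CuspForm (Gamma0 N₁) 2)
      (g : CuspForm (Gamma0 N₂) 2), IsNewform0 f → IsNewform0 g → RankinSelbergGRH f g)
    {ε : ℝ} (hε : 0 < ε) :
    ∃ N₀ : ℕ, ∀ (W : WeierstrassCurve ℚ) [W.IsElliptic], N₀ ≤ W.conductorNorm ℤ →
      W.faltingsHeight <
          (1 / 12 + ε) * (W.conductorNorm ℤ : ℝ) * Real.log (Real.log (W.conductorNorm ℤ : ℝ)) ∧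
        Real.log (W.minimalDiscriminantNorm ℤ : ℝ) <
          (1 + ε) * (W.conductorNorm ℤ : ℝ) * Real.log (Real.log (W.conductorNorm ℤ : ℝ)) := by
  obtain ⟨K, hK0, hK⟩ := Pasten2024.exists_log_modularDegree_le_loglog_of_thm_7_3_trivialBound h73
  obtain ⟨N₂, hN₂⟩ := exists_nat_lt_loglog ((6 * K + 170) / ε)
  refine ⟨max 16 N₂, fun W _ hNW => ?_⟩
  -- a global minimal model `C • W` (same height, minimal discriminant and conductor)
  obtain ⟨C, hC⟩ := hasGlobalMinimalModel_rat_holds W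
  haveI := hC
  have hN : (C • W).conductorNorm ℤ = W.conductorNorm ℤ := conductorNorm_smul_rat W C
  haveI : NeZero ((C • W).conductorNorm ℤ) := ⟨(conductorNorm_pos_holds (C • W)).ne'⟩
  rw [← faltingsHeight_smul W C, ← minimalDiscriminantNorm_smul_rat W C, ← hN]
  have hN16 : 16 ≤ (C • W).conductorNorm ℤ := by rw [hN]; exact le_trans (le_max_left _ _) hNW
  have hNN₂ : N₂ ≤ (C • W).conductorNorm ℤ := by rw [hN]; exact le_trans (le_max_right _ _) hNW
  set N : ℕ := (C • W).conductorNorm ℤ with hNdef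
  obtain ⟨hL, hM⟩ := two_le_log_and_one_le_loglog hN16
  have hT : (6 * K + 170) / ε < Real.log (Real.log (N : ℝ)) := hN₂ N hNN₂
  have hN' : (16 : ℝ) ≤ N := by exact_mod_cast hN16
  set L : ℝ := Real.log N with hLdef
  set M : ℝ := Real.log L with hMdef
  -- the class bound `log δ₀ < B` at level `N` under GRH
  set B : ℝ := (1 / 6 : ℝ) * N * M + K * N + 1 with hBdef
  have hB : ∀ (W₀ : WeierstrassCurve ℚ) [W₀.IsElliptic] (D₀ : ModularParametrizationData W₀ N),
      (∀ (W'' : WeierstrassCurve ℚ) [W''.IsElliptic] (D'' : ModularParametrizationData W'' N),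
          D''.f = D₀.f → D₀.modularDegree ≤ D''.modularDegree) →
        Real.log (D₀.modularDegree : ℝ) < B := fun W₀ _ D₀ hmin => by
    have h1 := hK N hN16 (fun M' _ _ f g hf hg => ⟨hGRH N N f f hf hf, hGRH N M' f g hf hg⟩) W₀ D₀ hmin
    rw [hBdef]
    linarith
  -- (EqHDeg): the height; (EqDiscH): the discriminant
  have hh := faltingsHeight_le_of_class_bound hmod h163 (C • W) hB
  have hc := eqHDeg_const_lt
  have hΔ := log_minimalDiscriminantNorm_le_of_modularity' hmod (C • W)
  have hmd := log_minModularDegree_le_of_class_bound h163 (hmod (C • W)) hB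
  have hl163 : Real.log 163 < 5.55 := by
    have h163 : Real.log 163 ≤ 8 * Real.log 2 := by
      rw [← Real.log_rpow (by norm_num), show ((2 : ℝ) ^ (8 : ℝ)) = 256 by norm_num]
      exact Real.log_le_log (by norm_num) (by norm_num)
    have hl2 := Real.log_two_lt_d9
    linarith
  -- `(6K + 170) N < ε N M` from `M > (6K + 170)/ε`
  have hKlt : 6 * K + 170 < ε * M := by rw [div_lt_iff₀ hε] at hT; linarith
  have hεNM : (6 * K + 170) * (N : ℝ) < ε * (N : ℝ) * M := by nlinarith
  have hN1 : (1 : ℝ) ≤ N := by linarith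
  constructor
  · rw [hBdef] at hh
    nlinarith
  · rw [hBdef] at hmd
    nlinarith

section Abc

open UniqueFactorizationMonoid IsDedekindDomain

/-- **A1.P(GRH) from {modularity, Mazur–Kenku, Thm 7.3} + GRH: `log c ≤ 1537 · rad(abc) · log log
rad(abc)` for `c ≥ c₀`** — the SAME conclusion as the sibling's `abc_log_le_mul_rad_mul_loglog_of_grh`,
with Deligne's weight-`2` bound REMOVED from the hypotheses: `faltingsHeight_discriminant_lt_loglog_of_grh_of_thm_7_3`
at `ε = 1/2` gives `log|Δ_E| < (3/2) N log log N` for `N ≫ 1`, and the sibling's Frey-curve translation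
`exists_abc_log_le_of_discriminant_loglogBound` (`1 + 1024 · 3/2 = 1537`). GRH is a hypothesis; still
exponential in `rad(abc)`; no claim on `abc`.
[cite: PastenShimura2024, Theorem 7.5 (GRH clause) with §3 (Frey–Hellegouarch curves), arXiv pp. 13, 27] [cite: MurtyPasten2013, §8] -/
theorem abc_log_le_mul_rad_mul_loglog_of_grh_of_thm_7_3 (hmod : nonempty_modularParametrizationData)
    (h163 : PastenShimura2024_minimalDegree_le_163_mul) (h73 : PastenShimura2024_thm_7_3)
    (hGRH : ∀ (N₁ N₂ : ℕ) [NeZero N₁] [NeZero N₂] (f : CuspForm (Gamma0 N₁) 2)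
      (g : CuspForm (Gamma0 N₂) 2), IsNewform0 f → IsNewform0 g → RankinSelbergGRH f g) :
    ∃ c₀ : ℝ, ∀ a b c : ℕ, IsABCTriple a b c → c₀ ≤ (c : ℝ) →
      Real.log c ≤ 1537 * (rad a b c : ℝ) * Real.log (Real.log (rad a b c : ℝ)) := by
  obtain ⟨N₀, hN₀⟩ := faltingsHeight_discriminant_lt_loglog_of_grh_of_thm_7_3 hmod h163 h73 hGRH
    (show (0 : ℝ) < 1 / 2 by norm_num)
  have h := exists_abc_log_le_of_discriminant_loglogBound (A := 3 / 2) (N₀ := N₀) (by norm_num)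
    (fun W _ hNW => by
      have := (hN₀ W hNW).2
      have h32 : (1 + 1 / 2 : ℝ) = 3 / 2 := by norm_num
      rw [h32] at this
      exact this.le)
  norm_num at h
  exact h

end Abc

end Literature.NumberTheory.EllipticCurves

end
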